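import Summits.QuantumAdvantage.QuantumAdvantage.Theorems.RingFrameRingToElimStubs
import Summits.QuantumAdvantage.AdviceFreeQNC0.TwoBlindSpotsForms
import HarnessLib

/-!
# Route RingFrame, crux α `RingToElim` (stmt-QuantumAdvantage-19119): α IS ITS TOTALLY SIGHTED
# CASE — hardness for strategies whose every polylog block of cuts reads all but at most one
# outside bit gives `RingToElim`

The two-blind-spots theorem (THEOREM-TARGET T8 of planner qa-qnc0-p1, ROUND-10 / Sketch11 §23;
kernel: `ringWinU_twoBlind_glue3_le`, `ringWinU_le_of_not_totallySighted`,
`AdviceFreeQNC0/TwoBlindSpots*.lean`): there is `θ₂ < 1` such that for every `C` and all large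
`n`, a walk strategy of degree `≤ (log₂ n)^C` admitting ONE block of `M = (log₂ n)^{2C+1}` input
bits and TWO bit positions `i ≠ j` outside it that no cut strictly inside the block reads, wins the
ring game in walk coordinates on at most `θ₂·2ⁿ` inputs — every other selector unrestricted.
Hence the crux `RingHardU` follows from its restriction to TOTALLY SIGHTED strategies
(`TotallySighted M y`, Sketch11 §23.4 verbatim in `TwoBlindSpotsForms.lean`): for every block of
`M` input bits and every two distinct positions outside it, some cut strictly inside the block
reads one of the two — equivalently, the `M − 1` interior selectors of every block JOINTLY READ
ALL BUT AT MOST ONE of the `n − M` outside bits: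

* `ringHardU_of_totallySightedHard` — totally-sighted hardness (the antecedent of Sketch11's
  `RingToElimOfTotallySightedHard`, verbatim) `→ RingHardU`;
* `ringHard_two_of_totallySightedHard`, `ringToElim_of_totallySightedHard` — then `RingHard 2`
  (`stub_transport`) and the crux `RingToElim` BY NAME; the type of the latter is Sketch11 §23.4
  `RingToElimOfTotallySightedHard` verbatim (hypothesis and conclusion).

This supersedes `ringToElim_of_crossReadingHard` (one selector reading one bit across a polylog
gap) and `ringToElim_of_sightedHard` as the route's sharpest reduction (ask P12 of ROUND-10).
The cell's statement (planner qa-qnc0-p1 gen 11; prover qn-prover-3 gen 4); not in print.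
WHAT THIS IS NOT: totally-sighted hardness is NOT proved (it is α proper: low-degree selectors can
jointly read everything); conditional results credit nothing; no separation.
-/

-- the sub-problem namespace `Summit.QuantumAdvantage.QuantumAdvantage` repeats the summit name by design (D-0017)
set_option linter.dupNamespace false

noncomputable section

namespace Summit.QuantumAdvantage.QuantumAdvantage.Theorems

open Finset Summit.QuantumAdvantage.AdviceFreeQNC0 RingToElim
open Literature.Computability.MetaComplexity Literature.Computability.MetaComplexity.Smolensky

/-- **α is its totally sighted case.**  If there is `θ < 1` such that for every `C` and all large
`n` every `(log₂ n)^{2C+1}`-TOTALLY SIGHTED walk strategy of degree `≤ (log₂ n)^C` wins the ring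
game at charge `n + 2` on at most `θ·2ⁿ` inputs, then `RingHardU` (all strategies): a strategy
that is not totally sighted has a block with two blind outside bits and
`ringWinU_le_of_not_totallySighted` bounds it.  (Cell statement; conditional on the hypothesis.) -/
theorem ringHardU_of_totallySightedHard
    (h : ∃ θ : ℝ, θ < 1 ∧ ∀ C : ℕ, ∃ n₀ : ℕ, ∀ n ≥ n₀, ∀ y : Fin (n + 1) → (Fin n → Bool) → Bool,
      (∀ g, HasDeg (y g) ((Nat.log 2 n) ^ C)) → TotallySighted ((Nat.log 2 n) ^ (2 * C + 1)) y →
      ((univ.filter fun u : Fin n → Bool => ringWinU (n + 2) y u = true).card : ℝ) ≤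
        θ * (2 : ℝ) ^ n) :
    RingHardU := by
  obtain ⟨θ₁, hθ₁, h₁⟩ := h
  obtain ⟨θ₂, hθ₂, h₂⟩ := ringWinU_le_of_not_totallySighted
  refine ⟨max θ₁ θ₂, max_lt hθ₁ hθ₂, fun C => ?_⟩
  obtain ⟨n₁, hn₁⟩ := h₁ C
  obtain ⟨n₂, hn₂⟩ := h₂ C
  refine ⟨max n₁ n₂, fun n hn y hdeg => ?_⟩
  have hn₁n : n₁ ≤ n := le_trans (le_max_left _ _) hn
  have hn₂n : n₂ ≤ n := le_trans (le_max_right _ _) hn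
  have hpow : (0 : ℝ) ≤ (2 : ℝ) ^ n := by positivity
  by_cases hts : TotallySighted ((Nat.log 2 n) ^ (2 * C + 1)) y
  · -- totally sighted: the hypothesis
    calc ((univ.filter fun u : Fin n → Bool => ringWinU (n + 2) y u = true).card : ℝ)
        ≤ θ₁ * (2 : ℝ) ^ n := hn₁ n hn₁n y hdeg hts
      _ ≤ max θ₁ θ₂ * (2 : ℝ) ^ n := mul_le_mul_of_nonneg_right (le_max_left _ _) hpow
  · -- not totally sighted: two blind spots
    calc ((univ.filter fun u : Fin n → Bool => ringWinU (n + 2) y u = true).card : ℝ)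
        ≤ θ₂ * (2 : ℝ) ^ n := hn₂ n hn₂n (n + 2) y hdeg hts
      _ ≤ max θ₁ θ₂ * (2 : ℝ) ^ n := mul_le_mul_of_nonneg_right (le_max_right _ _) hpow

/-- **Totally-sighted hardness gives the rung statement `RingHard 2`** (through `stub_transport`). -/
theorem ringHard_two_of_totallySightedHard
    (h : ∃ θ : ℝ, θ < 1 ∧ ∀ C : ℕ, ∃ n₀ : ℕ, ∀ n ≥ n₀, ∀ y : Fin (n + 1) → (Fin n → Bool) → Bool,
      (∀ g, HasDeg (y g) ((Nat.log 2 n) ^ C)) → TotallySighted ((Nat.log 2 n) ^ (2 * C + 1)) y →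
      ((univ.filter fun u : Fin n → Bool => ringWinU (n + 2) y u = true).card : ℝ) ≤
        θ * (2 : ℝ) ^ n) :
    Summit.QuantumAdvantage.AdviceFreeQNC0.RingHard 2 :=
  stub_transport (ringHardU_of_totallySightedHard h)

/-- **Totally-sighted hardness gives the crux α `RingToElim` by name** (Sketch11 §23.4
`RingToElimOfTotallySightedHard`; the antecedent `ElimHard` of `RingToElim` is not even needed: it
is a theorem, `elimHard_holds`). -/
theorem ringToElim_of_totallySightedHard
    (h : ∃ θ : ℝ, θ < 1 ∧ ∀ C : ℕ, ∃ n₀ : ℕ, ∀ n ≥ n₀, ∀ y : Fin (n + 1) → (Fin n → Bool) → Bool,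
      (∀ g, HasDeg (y g) ((Nat.log 2 n) ^ C)) → TotallySighted ((Nat.log 2 n) ^ (2 * C + 1)) y →
      ((univ.filter fun u : Fin n → Bool => ringWinU (n + 2) y u = true).card : ℝ) ≤
        θ * (2 : ℝ) ^ n) :
    Summit.QuantumAdvantage.QuantumAdvantage.Theses.RingFrame.RingToElim :=
  fun _ => ringHard_two_of_totallySightedHard h

end Summit.QuantumAdvantage.QuantumAdvantage.Theorems
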